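/-
Copyright: statement-level skeleton of a published paper (lit-balaban cell, Phase-2 proof seat p25, gen 18). No proof
claims beyond what the kernel checks below.
-/
import Literature.MathematicalPhysics.QuantumFieldTheory.BalabanImbrieJaffe1984to88.BIJ88WalkIdentity311
import Literature.MathematicalPhysics.QuantumFieldTheory.BalabanImbrieJaffe1984to88.BIJ88Resummation312

/-!
# `BalabanImbrieJaffe1984to88.BIJ88WalkResummation312` — T. Bałaban, J. Imbrie, A. Jaffe, *Effective action and
cluster properties of the abelian Higgs model*, Commun. Math. Phys. **114** (1988) 257–315 [BalabanImbrieJaffe1988],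
§5.14 p. 312 [PDF 56] *"We can arrange the construction so that the {X_c} are determined once the remainder components
are specified. Summing all possible diagrams in X_c gives the observable for the next step there, F^L_{k+1,loc}(X_c).
Summing all terms in X_r gives an observable F_{k,rem}(X_r). Then the result of the integration by parts is
⟨Π_{σ_i} F^{m̄}_{k,loc}(X_{σ_i})⟩ = Σ_{{X_r}} Π_{c: X_c ⊄ ∪_r X_r} F^L_{k+1,loc}(X_c) ⟨Π_r F_{k,rem}(X_r)⟩"* — **THE
RESUMMATION OVER THE CONSTANT COMPONENTS FOR THE EXPANSION WITH THE COVARIANCE SPLIT** (p25 gen 18): the gen-16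
resummation `BIJ88Resummation312.expand_resum` re-proved for `BIJ88WalkExpansion311.expand` (every contraction
through every piece of `A⁻¹ = Σ_p Cov p`, components completed by random-walk terms set aside as remainder components):
`Σ_t coef_t ∫(t) = Σ_{O ⊆ K} CST(K ∖ O) · REM(O)`, `CST(C)` = the all-constant part of the expansion of `C` ALONE (each
constant component — no `χ′`, fewer than `M` vertices, NO RANDOM-WALK TERM, all legs contracted — its own sum of
connected constant diagrams `F^L`), `REM(O)` = the terms of the expansion of `O` ALONE with no constant component.  The
mechanism is unchanged: the two environment lemmas of `BIJ88WalkRunEnv311`.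

statement-level skeleton of published theorems with citation tags; proofs where landed; nothing here is a claim
about the Yang–Mills mass gap

PDF held: `paper:balaban1988-cmp114-bij-abelian-higgs-effective-action` (journal page = PDF page + 256); p. 311–312 =
PDF 55–56 (`p0055.txt` L23–38, `p0056.txt` L1–9 re-read this session, 2026-08-22).

CITATION HEADER (lean-in-tree rule).  lit-balaban cell (HOME `run/shared/lean/pub/lit-balaban/`), Phase 2, seat p25
gen 18; row **C2.Claim@312** of `HOME/lit-balaban-r16/ROWS-C2-part2.md` (owner r16, referee ref-5; head
`BIJ88Sect5StatementsPart4.Ineq312` untouched).  USED BY NAME, nothing restated: `BIJ88WalkRun311.{run, pristine, WGrp,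
WOut}`, `BIJ88WalkRunEnv311.{run_filter_env, run_filter_const, run_const, run_rest_subset, run_done_le,
run_complete, run_lab}`, `BIJ88WalkExpansion311.{expand, expand_sound, WTerm, oact}`, `BIJ88WalkIdentity311.{tval,
tval_act, tval_addConst}` (this seat and generation); the generic sum bookkeeping `BIJ88Resummation312.{sum_map_ite,
sum_map_finset_sum_comm, powerset_filter_subset, sum_powerset_sdiff_reindex, min'_eq_of_subset, sum_mbind,
sdiff_insert_eq_erase_sdiff, sdiff_erase_eq_erase_sdiff}` and `BIJ88LabelledRun311.{filter_mbind, map_mbind, mem_mbind}`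
(p25 gen 16).

## What is proved (0 `sorry`, standard axioms, no new `Prop` facts; definitions with bodies: `cst`, `fl`, `remv`)

* §1 `cst` (all constant components of `C` together), `fl` (ONE constant component: the run of the least observable
  absorbing exactly `B`, ending constant — in particular through local pieces only), `remv` (all remainder components of
  `O` together, under the integral); **`cst_step`**, **`remv_step`**; `expand_lab`.
* §2 `sum_filter_env`, `cst_env`, `remv_env` (the environment lemmas in sum form).
* §3 **`expand_resum`**: `Σ_{t ∈ expand done rest} tval D t = Σ_{O ⊆ rest} cst (rest ∖ O) · remv D done O`.
HONEST SCOPE: (a) contraction-graph components, fixed order of events, observables taken up in the order of `κ`;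
(b) `REM(O)` is one block; (c) no estimates; (d) no `Ineq312`/`hobs` binder instantiated.  NOT summit progress; NOT
continuum; NOT Clay.  Imports `BIJ88WalkIdentity311`, `BIJ88Resummation312` (generic sum lemmas only); modifies nothing.
-/

noncomputable section

namespace Literature.MathematicalPhysics.QuantumFieldTheory.BalabanImbrieJaffe1984to88.BIJ88WalkResummation312

open Classical MeasureTheory Matrix Finset
open scoped BigOperators
open BIJ88LabelledRun311 (fbind mbind mem_mbind filter_mbind map_mbind)
open BIJ88Resummation312 (sum_map_ite sum_map_finset_sum_comm powerset_filter_subset sum_powerset_sdiff_reindex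
  min'_eq_of_subset sum_mbind sdiff_insert_eq_erase_sdiff sdiff_erase_eq_erase_sdiff)
open BIJ88WalkRun311 BIJ88WalkRunEnv311 BIJ88WalkExpansion311 BIJ88WalkIdentity311

variable {S : Type} [Fintype S] {ι : Type} [Fintype ι] {κ : Type} [LinearOrder κ] {P : Type} [Fintype P]

/-! ## §1  The constant part, one constant component, the remainder part; one observable taken up -/

variable (A : Matrix S S ℝ) (Cov : P → Matrix S S ℝ) (trig : P → Bool) (f : S → ℝ) (c : ι → ℝ)
  (legs : ι → List (S → ℝ)) (obs : κ → List (S → ℝ)) (M : ℕ) (χ : (S → ℝ) → ℝ)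

/-- **The constant part of the observables `C`** (*"Summing all possible diagrams in X_c gives … F^L_{k+1,loc}(X_c)"*,
over all the constant components together): the sum of the coefficients of the terms of the expansion of `C` alone
in which every component is constant — field-independent numbers. [cite: BalabanImbrieJaffe1988, §5.14 p.312] -/
def cst (C : Finset κ) : ℝ :=
  (((expand Cov trig f c legs obs M 0 C).filter fun t => t.groups = 0).map WTerm.coef).sum

/-- **One constant component `F^L`**: the sum of the weights of the runs of the pristine observable `i` in the
environment `B` that end CONSTANT having absorbed all of `B` — all connected constant diagrams on `{i} ∪ B`.
[cite: BalabanImbrieJaffe1988, §5.14 p.312] -/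
def fl (i : κ) (B : Finset κ) : ℝ :=
  (((run Cov trig f c legs obs M (pristine obs i) B 0).filter fun o => o.g.IsConst M ∧ o.rest = ∅).map WOut.a).sum

/-- **The remainder part of the observables `O`** (*"Summing all terms in X_r gives an observable F_{k,rem}(X_r)"*,
all remainder components together, under the integral): the value of the terms of the expansion of `O` (with `done`
set aside, directions `D` present) that have NO constant component. [cite: BalabanImbrieJaffe1988, §5.14 p.312] -/
def remv (D : List (S → ℝ)) (done : Multiset (WGrp S κ ι P)) (O : Finset κ) : ℝ :=
  (((expand Cov trig f c legs obs M done O).filter fun t => t.consts = 0).map (tval A f c legs χ D)).sum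

variable {A Cov trig f c legs obs M χ}

/-- **One observable taken up, constant part**: for `C` non-empty with least observable `i`, `cst C` is the sum over
the CONSTANT outcomes `o` of the run of `i` in `C ∖ i` (nothing set aside) of `a_o · cst(o.rest)` — the component of
`i` is one constant component, the untouched observables organise independently.
[cite: BalabanImbrieJaffe1988, §5.14 p.312] -/
theorem cst_step {C : Finset κ} (h : C.Nonempty) :
    cst Cov trig f c legs obs M C
      = (((run Cov trig f c legs obs M (pristine obs (C.min' h)) (C.erase (C.min' h)) 0).filter fun o => o.g.IsConst M).map
          fun o => o.a * cst Cov trig f c legs obs M o.rest).sum := by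
  rw [cst, expand_of_nonempty Cov trig f c legs obs M h, filter_mbind, map_mbind, sum_mbind, ← sum_map_ite,
    ← Multiset.attach_map_val' (run Cov trig f c legs obs M (pristine obs (C.min' h)) (C.erase (C.min' h)) 0)]
  refine congrArg _ (Multiset.map_congr rfl fun o _ => ?_)
  have ho := o.2
  have hd0 : o.1.done = 0 := Multiset.le_zero.1 (run_done_le _ _ _ _ ho)
  split_ifs with hg
  · -- a constant component: the blocks do not touch `groups`; coefficients scale by `a_o`
    rw [Multiset.filter_map, Multiset.map_map, cst, hd0, ← Multiset.sum_map_mul_left]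
    rfl
  · -- a remainder component is set aside: every term has a set-aside component, none is all-constant
    rw [Multiset.filter_map, Multiset.filter_eq_nil.2, Multiset.map_zero, Multiset.map_zero, Multiset.sum_zero]
    intro t ht
    have hd' : ∀ h' ∈ o.1.g ::ₘ o.1.done, h'.complete M = true := fun h' hh => by
      rcases Multiset.mem_cons.1 hh with rfl | hh
      · exact run_complete _ _ _ _ ho
      · rw [hd0] at hh; exact absurd hh (Multiset.notMem_zero _)
    exact (expand_sound _ _ _ (Nat.lt_succ_self _) hd' t ht).2.2 (Multiset.cons_ne_zero)

/-- **One observable taken up, remainder part**: for `i` below every observable of `O'`, `remv D done (insert i O')`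
is the sum over the REMAINDER outcomes `o` of the run of `i` in `O'` of `a_o · remv (D ++ D_o) (o.g :: o.done) o.rest`.
[cite: BalabanImbrieJaffe1988, §5.14 p.312] -/
theorem remv_step {O' : Finset κ} {i : κ} (hi : ∀ j ∈ O', i < j) (D : List (S → ℝ)) (done : Multiset (WGrp S κ ι P)) :
    remv A Cov trig f c legs obs M χ D done (insert i O')
      = (((run Cov trig f c legs obs M (pristine obs i) O' done).filter fun o => ¬ o.g.IsConst M).map
          fun o => o.a * remv A Cov trig f c legs obs M χ (D ++ o.D) (o.g ::ₘ o.done) o.rest).sum := by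
  have hne : (insert i O').Nonempty := Finset.insert_nonempty _ _
  have hiO : i ∉ O' := fun h => lt_irrefl _ (hi i h)
  have hmin : (insert i O').min' hne = i :=
    le_antisymm (Finset.min'_le _ _ (Finset.mem_insert_self _ _))
      (Finset.le_min' _ _ _ fun y hy => by
        rcases Finset.mem_insert.1 hy with rfl | hy
        · exact le_rfl
        · exact (hi y hy).le)
  have her : (insert i O').erase ((insert i O').min' hne) = O' := by rw [hmin, Finset.erase_insert hiO]
  rw [remv, expand_of_nonempty Cov trig f c legs obs M hne, filter_mbind, map_mbind, sum_mbind, ← sum_map_ite, her, hmin,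
    ← Multiset.attach_map_val' (run Cov trig f c legs obs M (pristine obs i) O' done)]
  refine congrArg _ (Multiset.map_congr rfl fun o _ => ?_)
  split_ifs with hg
  · -- a constant component is booked as a block: no term without blocks
    rw [Multiset.filter_map, Multiset.filter_eq_nil.2, Multiset.map_zero, Multiset.map_zero, Multiset.sum_zero]
    intro t _
    simp only [Function.comp_apply, WTerm.addConst_consts]
    exact Multiset.cons_ne_zero
  · rw [Multiset.filter_map, Multiset.map_map, remv, ← Multiset.sum_map_mul_left]
    refine congrArg _ (Multiset.map_congr rfl fun t _ => ?_)
    rw [Function.comp_apply, tval_act]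

/-- **The blocks and the set-aside components of a term carry all the observables** (label bookkeeping for the
reading `X_c`, `X_r` ⊆ observables): for every term of `expand done rest`, the union of the labels of its constant
components and of its set-aside components is the union of the labels of `done` and `rest`.
[cite: BalabanImbrieJaffe1988, §5.14 p.311–312] -/
theorem expand_lab : ∀ (n : ℕ) (done : Multiset (WGrp S κ ι P)) (rest : Finset κ), rest.card < n →
    ∀ t ∈ expand Cov trig f c legs obs M done rest,
      ((t.consts + t.groups).map WGrp.lab).sup = (done.map WGrp.lab).sup ∪ rest
  | 0, _, _, hn => fun _ _ => absurd hn (Nat.not_lt_zero _)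
  | n + 1, done, rest, hn => by
    intro t ht
    by_cases h : rest.Nonempty
    · rw [expand_of_nonempty Cov trig f c legs obs M h, mem_mbind] at ht
      obtain ⟨o, ho, ht⟩ := ht
      have hcard : o.rest.card < n := lt_of_lt_of_le (lt_of_le_of_lt (Finset.card_le_card (run_rest_subset _ _ _ o ho))
        (Finset.card_erase_lt_of_mem (rest.min'_mem h))) (Nat.lt_succ_iff.1 hn)
      have hl := run_lab _ _ _ o ho
      simp only [pristine] at hl
      have hrest : (done.map WGrp.lab).sup ∪ rest = o.g.lab ∪ (o.done.map WGrp.lab).sup ∪ o.rest := by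
        rw [hl, Finset.union_comm {rest.min' h}, Finset.union_assoc, ← Finset.insert_eq,
          Finset.insert_erase (rest.min'_mem h)]
      split_ifs at ht with hg
      · rw [Multiset.mem_map] at ht
        obtain ⟨t', ht', rfl⟩ := ht
        have ih := expand_lab n o.done o.rest hcard t' ht'
        rw [hrest, WTerm.addConst_consts, oact_consts, WTerm.addConst_groups, oact_groups, Multiset.cons_add,
          Multiset.map_cons, Multiset.sup_cons, ih, Finset.sup_eq_union, Finset.union_assoc]
      · rw [Multiset.mem_map] at ht
        obtain ⟨t', ht', rfl⟩ := ht
        have ih := expand_lab n (o.g ::ₘ o.done) o.rest hcard t' ht'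
        rw [hrest, oact_consts, oact_groups, ih, Multiset.map_cons, Multiset.sup_cons, Finset.sup_eq_union,
          Finset.union_assoc]
    · rw [expand_of_not_nonempty Cov trig f c legs obs M h, Multiset.mem_singleton] at ht
      subst ht
      rw [Finset.not_nonempty_iff_eq_empty.1 h, Finset.union_empty, zero_add]

/-! ## §2  The environment lemmas in sum form -/

/-- **A run sees only the observables it absorbs, in sums**: for `B ⊆ R`, a `φ`-stable selection `p` of outcomes and
any weight `ψ`, summing `ψ` over the selected outcomes of the run in `R` that leave `R ∖ B` untouched is summing
`ψ ∘ (rest ∪= R ∖ B)` over the selected outcomes of the run in `B`. [cite: BalabanImbrieJaffe1988, §5.14 p.312] -/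
theorem sum_filter_env {g : WGrp S κ ι P} {R B : Finset κ} (hB : B ⊆ R) (done : Multiset (WGrp S κ ι P))
    (p : WOut S κ ι P → Prop) [DecidablePred p] (hp : ∀ o : WOut S κ ι P, p { o with rest := o.rest ∪ (R \ B) } ↔ p o)
    (ψ : WOut S κ ι P → ℝ) :
    (((run Cov trig f c legs obs M g R done).filter p).map fun o => if R \ B ⊆ o.rest then ψ o else 0).sum
      = (((run Cov trig f c legs obs M g B done).filter p).map fun o => ψ { o with rest := o.rest ∪ (R \ B) }).sum := by
  rw [sum_map_ite, Multiset.filter_filter]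
  have e : (run Cov trig f c legs obs M g R done).filter (fun o => R \ B ⊆ o.rest ∧ p o)
      = ((run Cov trig f c legs obs M g R done).filter fun o => R \ B ⊆ o.rest).filter p := by
    rw [Multiset.filter_filter]
    exact Multiset.filter_congr fun o _ => and_comm
  rw [e, run_filter_env _ _ _ _ (Nat.lt_succ_self _) B hB, Multiset.filter_map, Multiset.map_map]
  refine congrArg _ (Multiset.map_congr ?_ fun o _ => rfl)
  exact Multiset.filter_congr fun o _ => hp o

/-- The constant part seen from a bigger environment: for `O ⊆ R`, the constant outcomes of the run in `R ∖ O`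
weighted by `cst(o.rest)` are the constant outcomes of the run in `R` leaving `O` untouched, weighted by
`cst(o.rest ∖ O)`. [cite: BalabanImbrieJaffe1988, §5.14 p.312] -/
theorem cst_env {g : WGrp S κ ι P} {R O : Finset κ} (hO : O ⊆ R) :
    (((run Cov trig f c legs obs M g (R \ O) 0).filter fun o => o.g.IsConst M).map
        fun o => o.a * cst Cov trig f c legs obs M o.rest).sum
      = (((run Cov trig f c legs obs M g R 0).filter fun o => o.g.IsConst M).map
        fun o => if O ⊆ o.rest then o.a * cst Cov trig f c legs obs M (o.rest \ O) else 0).sum := by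
  have hRO : R \ (R \ O) = O := Finset.sdiff_sdiff_eq_self hO
  have h := sum_filter_env (Cov := Cov) (trig := trig) (f := f) (c := c) (legs := legs) (obs := obs) (M := M) (g := g)
    (Finset.sdiff_subset : R \ O ⊆ R) 0 (fun o => o.g.IsConst M) (fun o => Iff.rfl)
    (fun o => o.a * cst Cov trig f c legs obs M (o.rest \ O))
  rw [hRO] at h
  rw [h]
  refine congrArg _ (Multiset.map_congr rfl fun o ho => ?_)
  have hr : o.rest ⊆ R \ O := run_rest_subset _ _ _ o (Multiset.mem_of_mem_filter ho)
  have hd : Disjoint o.rest O := Finset.disjoint_of_subset_left hr Finset.sdiff_disjoint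
  simp only [Finset.union_sdiff_cancel_right hd]

/-- The remainder part seen from a bigger environment: for `O' ⊆ R`, the remainder outcomes of the run in `O'`
weighted by `remv(…, o.rest)` are the remainder outcomes of the run in `R` leaving `R ∖ O'` untouched, weighted by
`remv(…, o.rest ∖ (R ∖ O'))`. [cite: BalabanImbrieJaffe1988, §5.14 p.312] -/
theorem remv_env {g : WGrp S κ ι P} {R O' : Finset κ} (hO' : O' ⊆ R) (D : List (S → ℝ)) (done : Multiset (WGrp S κ ι P)) :
    (((run Cov trig f c legs obs M g O' done).filter fun o => ¬ o.g.IsConst M).map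
        fun o => o.a * remv A Cov trig f c legs obs M χ (D ++ o.D) (o.g ::ₘ o.done) o.rest).sum
      = (((run Cov trig f c legs obs M g R done).filter fun o => ¬ o.g.IsConst M).map
        fun o => if R \ O' ⊆ o.rest then o.a * remv A Cov trig f c legs obs M χ (D ++ o.D) (o.g ::ₘ o.done) (o.rest \ (R \ O'))
          else 0).sum := by
  have h := sum_filter_env (Cov := Cov) (trig := trig) (f := f) (c := c) (legs := legs) (obs := obs) (M := M) (g := g) hO' done
    (fun o => ¬ o.g.IsConst M) (fun o => Iff.rfl)
    (fun o => o.a * remv A Cov trig f c legs obs M χ (D ++ o.D) (o.g ::ₘ o.done) (o.rest \ (R \ O')))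
  rw [h]
  refine congrArg _ (Multiset.map_congr rfl fun o ho => ?_)
  have hr : o.rest ⊆ O' := run_rest_subset _ _ _ o (Multiset.mem_of_mem_filter ho)
  have hd : Disjoint o.rest (R \ O') := Finset.disjoint_of_subset_left hr Finset.disjoint_sdiff
  simp only [Finset.union_sdiff_cancel_right hd]

/-! ## §3  The resummation -/

/-- **THE RESUMMATION OVER THE CONSTANT COMPONENTS** (p. 312, first display, second equality — derived): for complete
components `done` set aside, untouched observables `rest` and `χ′`-directions `D` already present,
`Σ_{t ∈ expand done rest} tval D t = Σ_{O ⊆ rest} cst(rest ∖ O) · remv D done O` — the observables `rest ∖ O` that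
end in constant components contribute the field-independent factor `cst(rest ∖ O)` (all their constant-component
structures, each component its `F^L`), computed from `rest ∖ O` ALONE; the observables `O` that end in remainder
components contribute `remv D done O`, computed from `O` (and what was set aside) ALONE.
[cite: BalabanImbrieJaffe1988, §5.14 p.312] -/
theorem expand_resum : ∀ (n : ℕ) (done : Multiset (WGrp S κ ι P)) (rest : Finset κ), rest.card < n →
    (∀ h ∈ done, h.complete M = true) → ∀ D : List (S → ℝ),
      ((expand Cov trig f c legs obs M done rest).map (tval A f c legs χ D)).sum
        = ∑ O ∈ rest.powerset, cst Cov trig f c legs obs M (rest \ O) * remv A Cov trig f c legs obs M χ D done O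
  | 0, _, _, hn => fun _ _ => absurd hn (Nat.not_lt_zero _)
  | n + 1, done, rest, hn => by
    intro hd D
    have IH : ∀ (done' : Multiset (WGrp S κ ι P)) (rest' : Finset κ), rest'.card < rest.card →
        (∀ h ∈ done', h.complete M = true) → ∀ D' : List (S → ℝ),
          ((expand Cov trig f c legs obs M done' rest').map (tval A f c legs χ D')).sum
            = ∑ O ∈ rest'.powerset, cst Cov trig f c legs obs M (rest' \ O) * remv A Cov trig f c legs obs M χ D' done' O :=
      fun done' rest' hlt => expand_resum n done' rest' (lt_of_lt_of_le hlt (Nat.lt_succ_iff.1 hn))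
    by_cases h : rest.Nonempty
    swap
    · -- no observable: one terminal term, `O = ∅`
      rw [Finset.not_nonempty_iff_eq_empty.1 h, Finset.powerset_empty, Finset.sum_singleton, Finset.sdiff_self, cst,
        remv, expand_of_not_nonempty Cov trig f c legs obs M Finset.not_nonempty_empty,
        expand_of_not_nonempty Cov trig f c legs obs M Finset.not_nonempty_empty, Multiset.filter_singleton, if_pos rfl,
        Multiset.filter_singleton, if_pos rfl]
      simp
    -- the least observable `i` runs in the environment `R = rest ∖ i`
    obtain ⟨i, hi⟩ : ∃ i, i = rest.min' h := ⟨_, rfl⟩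
    obtain ⟨R, hR⟩ : ∃ R, R = rest.erase i := ⟨_, rfl⟩
    have hirest : i ∈ rest := hi ▸ rest.min'_mem h
    have hiR : i ∉ R := hR ▸ Finset.notMem_erase i rest
    have hrest : rest = insert i R := by rw [hR, Finset.insert_erase hirest]
    have hRsub : R ⊆ rest := hR ▸ Finset.erase_subset i rest
    have hRcard : R.card < rest.card := hR ▸ Finset.card_erase_lt_of_mem hirest
    have hlt : ∀ j ∈ R, i < j := fun j hj => by
      rw [hR] at hj
      exact lt_of_le_of_ne (hi ▸ Finset.min'_le _ _ (Finset.mem_of_mem_erase hj)) (Finset.ne_of_mem_erase hj).symm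
    -- one observable taken up, on the right-hand side: the two halves `i ∉ O` / `i ∈ O`
    have hcstO : ∀ O ∈ R.powerset, cst Cov trig f c legs obs M (rest \ O)
        = (((run Cov trig f c legs obs M (pristine obs i) (R \ O) 0).filter fun o => o.g.IsConst M).map
            fun o => o.a * cst Cov trig f c legs obs M o.rest).sum := fun O hO => by
      have hO := Finset.mem_powerset.1 hO
      have hiO : i ∈ rest \ O := Finset.mem_sdiff.2 ⟨hirest, fun h' => hiR (hO h')⟩
      have hne : (rest \ O).Nonempty := ⟨i, hiO⟩
      have hmin : (rest \ O).min' hne = i := by rw [hi] at hiO ⊢; exact min'_eq_of_subset h Finset.sdiff_subset hiO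
      rw [cst_step hne, hmin, sdiff_erase_eq_erase_sdiff, ← hR]
    have hremO : ∀ O' ∈ R.powerset, remv A Cov trig f c legs obs M χ D done (insert i O')
        = (((run Cov trig f c legs obs M (pristine obs i) O' done).filter fun o => ¬ o.g.IsConst M).map
            fun o => o.a * remv A Cov trig f c legs obs M χ (D ++ o.D) (o.g ::ₘ o.done) o.rest).sum := fun O' hO' =>
      remv_step (fun j hj => hlt j (Finset.mem_powerset.1 hO' hj)) D done
    rw [hrest, Finset.sum_powerset_insert hiR, ← hrest]
    -- THE LEFT-HAND SIDE: unfold one step; the value of each outcome's continuation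
    have hL : ((expand Cov trig f c legs obs M done rest).map (tval A f c legs χ D)).sum
        = ((run Cov trig f c legs obs M (pristine obs i) R done).map fun o =>
            if o.g.IsConst M then o.a * ((expand Cov trig f c legs obs M done o.rest).map (tval A f c legs χ D)).sum
            else o.a * ((expand Cov trig f c legs obs M (o.g ::ₘ o.done) o.rest).map (tval A f c legs χ (D ++ o.D))).sum).sum := by
      rw [expand_of_nonempty Cov trig f c legs obs M h, map_mbind, sum_mbind, ← hi, ← hR,
        ← Multiset.attach_map_val' (run Cov trig f c legs obs M (pristine obs i) R done)]
      refine congrArg _ (Multiset.map_congr rfl fun o _ => ?_)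
      have ho := o.2
      split_ifs with hg
      · obtain ⟨hD0, hdone, -⟩ := run_const _ _ _ _ ho hd hg
        rw [Multiset.map_map, ← Multiset.sum_map_mul_left]
        refine congrArg _ (Multiset.map_congr (by rw [hdone]) fun t _ => ?_)
        rw [Function.comp_apply, tval_addConst, tval_act, hD0, List.append_nil]
      · rw [Multiset.map_map, ← Multiset.sum_map_mul_left]
        refine congrArg _ (Multiset.map_congr rfl fun t _ => ?_)
        rw [Function.comp_apply, tval_act]
    rw [hL, ← Multiset.filter_add_not (fun o => o.g.IsConst M) (run Cov trig f c legs obs M (pristine obs i) R done),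
      Multiset.map_add, Multiset.sum_add]
    refine congrArg₂ (· + ·) ?_ ?_
    · -- CONSTANT outcomes: the component of `i` is a constant component; it saw neither `done` nor `O`
      have e1 : (((run Cov trig f c legs obs M (pristine obs i) R done).filter fun o => o.g.IsConst M).map fun o =>
            if o.g.IsConst M then o.a * ((expand Cov trig f c legs obs M done o.rest).map (tval A f c legs χ D)).sum
            else o.a * ((expand Cov trig f c legs obs M (o.g ::ₘ o.done) o.rest).map (tval A f c legs χ (D ++ o.D))).sum).sum
          = (((run Cov trig f c legs obs M (pristine obs i) R 0).filter fun o => o.g.IsConst M).map fun o =>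
            ∑ O ∈ R.powerset, (if O ⊆ o.rest then o.a * cst Cov trig f c legs obs M (o.rest \ O) else 0)
              * remv A Cov trig f c legs obs M χ D done O).sum := by
        rw [run_filter_const _ _ _ _ (Nat.lt_succ_self _) hd, Multiset.map_map]
        refine congrArg _ (Multiset.map_congr rfl fun o ho => ?_)
        obtain ⟨ho', hg⟩ := Multiset.mem_filter.1 ho
        have hsub : o.rest ⊆ R := run_rest_subset _ _ _ o ho'
        rw [Function.comp_apply]
        simp only [if_pos hg]
        rw [IH done o.rest (lt_of_le_of_lt (Finset.card_le_card hsub) hRcard) hd D, Finset.mul_sum,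
          ← powerset_filter_subset hsub, Finset.sum_filter]
        refine Finset.sum_congr rfl fun O _ => ?_
        split_ifs <;> ring
      rw [e1, sum_map_finset_sum_comm]
      refine Finset.sum_congr rfl fun O hO => ?_
      rw [Multiset.sum_map_mul_right, hcstO O hO, cst_env (Finset.mem_powerset.1 hO)]
    · -- REMAINDER outcomes: the component of `i` is set aside; the later components see it and `done`
      have e2 : (((run Cov trig f c legs obs M (pristine obs i) R done).filter fun o => ¬ o.g.IsConst M).map fun o =>
            if o.g.IsConst M then o.a * ((expand Cov trig f c legs obs M done o.rest).map (tval A f c legs χ D)).sum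
            else o.a * ((expand Cov trig f c legs obs M (o.g ::ₘ o.done) o.rest).map (tval A f c legs χ (D ++ o.D))).sum).sum
          = (((run Cov trig f c legs obs M (pristine obs i) R done).filter fun o => ¬ o.g.IsConst M).map fun o =>
            ∑ O' ∈ R.powerset, cst Cov trig f c legs obs M (R \ O') *
              (if R \ O' ⊆ o.rest then o.a * remv A Cov trig f c legs obs M χ (D ++ o.D) (o.g ::ₘ o.done) (o.rest \ (R \ O'))
               else 0)).sum := by
        refine congrArg _ (Multiset.map_congr rfl fun o ho => ?_)
        obtain ⟨ho', hg⟩ := Multiset.mem_filter.1 ho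
        have hsub : o.rest ⊆ R := run_rest_subset _ _ _ o ho'
        have hd' : ∀ h' ∈ o.g ::ₘ o.done, h'.complete M = true := fun h' hh => by
          rcases Multiset.mem_cons.1 hh with rfl | hh
          · exact run_complete _ _ _ o ho'
          · exact hd h' (Multiset.mem_of_le (run_done_le _ _ _ o ho') hh)
        simp only [if_neg hg]
        rw [IH _ o.rest (lt_of_le_of_lt (Finset.card_le_card hsub) hRcard) hd' (D ++ o.D),
          ← sum_powerset_sdiff_reindex hsub (fun X Y => cst Cov trig f c legs obs M X * remv A Cov trig f c legs obs M χ (D ++ o.D) (o.g ::ₘ o.done) Y),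
          Finset.mul_sum]
        refine Finset.sum_congr rfl fun O' _ => ?_
        split_ifs <;> ring
      rw [e2, sum_map_finset_sum_comm]
      refine Finset.sum_congr rfl fun O' hO' => ?_
      rw [Multiset.sum_map_mul_left, sdiff_insert_eq_erase_sdiff, ← hR, hremO O' hO',
        remv_env (Finset.mem_powerset.1 hO') D done]

end Literature.MathematicalPhysics.QuantumFieldTheory.BalabanImbrieJaffe1984to88.BIJ88WalkResummation312

end
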